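import Summits.AtomisticToContinuum.Crystallization.Theorems.FreeSplittingCertificatesStrictSplittingRuleTorusModel442A
import Summits.AtomisticToContinuum.Crystallization.Theorems.FreeSplittingCertificatesStrictSplittingRuleTorusModel442B

/-!
# Torus model 4×4×2: the norm, the mean and the zero-mean hypothesis in plain `Fintype`-sum form

Route `FreeSplittingCertificates`, crux `StrictSplittingRule` (stmt-AtomisticToContinuum-12560); unit b2b-freesplit-B (block 2b,
PART B, gen 1).  VALUE = readability of a FINITE-model theorem — NOT summit progress.

`…TorusModel442Defs.lean` defines `normSqG`, `meanProj` and the component sums `sumF c` through the term-list evaluator `evalQ`.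
Here they are unfolded into ordinary sums over the 64 sites (`Site = Fin 4 × Fin 4 × Fin 4`, coordinate `idx q c`):
`sumF_eval`, `normSqG_eval`, `meanProj_eval`, and the zero-mean theorems are restated with the hypothesis
`∀ c, ∑ q, u (idx q c) = 0` (`jointLMI442A_zeroMean'`, `jointLMI442B_zeroMean'`). [folklore]
-/

namespace Summit.AtomisticToContinuum.Crystallization.Theorems.StrictSplittingRuleTorusLMI

/-- `(sumF c)(u) = Σ_q u_(q,c)`. [folklore] -/
theorem sumF_eval (c : Fin 3) (u : Fin 192 → ℚ) : (sumF c).eval u = ∑ q : Site, u (idx q c) := by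
  simp only [Fintype.sum_prod_type, Fin.sum_univ_four]
  simp [sumF, allSites, LinF.eval, List.flatMap, List.finRange]
  ring

/-- `evalQ` over a `flatMap` is the sum of the pieces. [folklore] -/
theorem evalQ_flatMap {α : Type*} (l : List α) (f : α → List (Term 192)) (u : Fin 192 → ℚ) :
    evalQ (l.flatMap f) u = (l.map fun a => evalQ (f a) u).sum := by
  induction l with
  | nil => simp
  | cons a l ih => rw [List.flatMap_cons, evalQ_append, ih, List.map_cons, List.sum_cons]

/-- Summing over the site list `allSites` is summing over `Site`. [folklore] -/
theorem allSites_sum (g : Site → ℚ) : (allSites.map g).sum = ∑ q : Site, g q := by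
  simp only [Fintype.sum_prod_type, Fin.sum_univ_four]
  simp [allSites, List.flatMap, List.finRange]
  ring

/-- `‖u‖²_G = Σ_q (u_(q,0)² + 3 u_(q,1)² + u_(q,2)²)` (Cartesian norm in the scaled frame). [folklore] -/
theorem normSqG_eval (u : Fin 192 → ℚ) :
    normSqG u = ∑ q : Site, (u (idx q 0) ^ 2 + 3 * u (idx q 1) ^ 2 + u (idx q 2) ^ 2) := by
  unfold normSqG normTerms
  rw [evalQ_flatMap, ← allSites_sum]
  congr 1
  refine List.map_congr_left fun q _ => ?_
  simp [sq, gW, evalQ]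
  ring

/-- `meanProj u = Σ_c (g_c/64)·(Σ_q u_(q,c))²`. [folklore] -/
theorem meanProj_eval (u : Fin 192 → ℚ) :
    meanProj u = (1 / 64) * (∑ q : Site, u (idx q 0)) ^ 2 + (3 / 64) * (∑ q : Site, u (idx q 1)) ^ 2 +
      (1 / 64) * (∑ q : Site, u (idx q 2)) ^ 2 := by
  rw [← sumF_eval, ← sumF_eval, ← sumF_eval]
  unfold meanProj
  simp [projTerms, sq, gW, evalQ]
  ring

/-- **Zero-mean form, A site, plain hypothesis**: `Σ_q u_(q,c) = 0` for `c = 0, 1, 2` ⇒ `D_p(u) + m‖u‖²_G ≤ S_p(u) + T_p(u)`. -/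
theorem jointLMI442A_zeroMean' (u : Fin 192 → ℚ) (h0 : ∀ c : Fin 3, ∑ q : Site, u (idx q c) = 0) :
    demand siteA u + margin442 * normSqG u ≤ supply siteA u + transfer siteA u :=
  jointLMI442A_zeroMean u fun c => by rw [sumF_eval]; exact h0 c

/-- **Zero-mean form, B site, plain hypothesis.** -/
theorem jointLMI442B_zeroMean' (u : Fin 192 → ℚ) (h0 : ∀ c : Fin 3, ∑ q : Site, u (idx q c) = 0) :
    demand siteB u + margin442 * normSqG u ≤ supply siteB u + transfer siteB u :=
  jointLMI442B_zeroMean u fun c => by rw [sumF_eval]; exact h0 c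

end Summit.AtomisticToContinuum.Crystallization.Theorems.StrictSplittingRuleTorusLMI
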